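import Mathlib
import HarnessLib
import Summits.ResolutionOfSingularities.ResolutionOfSingularities.Theorems.WildQuotientsWildQuotientResolutionS1aQhRoot

/-!
# S1a — THE QUASI-HOMOGENEOUS ROOT (R4 normal form): the `[x₀]` and `[N(x₁)]` cover elements, their residual sections and radical step

[OURS · L1 W4.5c · lead-1 g16; R4a brick 4a (after ✓`…S1aQhRoot`); pattern ✓`…S1aSymCover` / ✓`…S1aSymSections` / ✓`…S1aA1Cover`, for GENERAL weights `w` with
`w 0 = w 1 + sh`] — NOT statements of the manuscript; counted 0; AI-level work, weaker than expert review. Crux stmt-ResolutionOfSingularities-17941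
`CyclicQuotientFourfolds`, line `s1a-logminvertex` v13 (`stub_reachLowerInFX`).

Centre `f = e⁻¹(x₀, x₁, x₂)`, weights `w`; norm `N₁ = ∏_{i : ZMod p} (e⁻¹x₁ + i·e⁻¹x₀)` (τ-fixed, ✓`A1.a1_norm_fixed`).
* `qh_cover_zero_mem` (`e⁻¹x₀ⁿ ∈ 𝒥_{dbar}`, `dbar = w₀·n`), `qh_norm_one_mem` (`N₁ ∈ 𝒥_{p·w₁}`), `qh_cover_one_mem` (`N₁ⁿ ∈ 𝒥_{dbar}`, `dbar = p·w₁·n`), `qh_cover_one_fixed`;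
* in `R^w`: `qh_norm_one_T`, `qh_coverElement_zero_eq` (`c₀ = u₀′ⁿ`), `qh_coverElement_one_eq` (`c₁ = (∏ᵢ (u₁′ + i·u₀′s^sh))ⁿ`);
* residual sections: `qh_u'_zero_pow_mem_reesPiece`, ★ `qh_residualSection_zero` (`u₀′ⁿ/c`: degree 0, in `𝔞·R_c`), `qh_residualSection_of_mem` (`v/c` for any `v ∈ 𝔞` of bidegree
  `(dbar, 0)` — e.g. another cover element);
* radical step `qh_rad_zero_one`: `u₀′, u₁′ ∈ √(c)` as soon as the family `c` contains `u₀′^{n₀}` and `(∏ᵢ (u₁′ + i·u₀′s^sh))^{n₁}`.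
-/

set_option linter.dupNamespace false

noncomputable section

open Literature.AlgebraicGeometry.Resolution
open scoped LaurentPolynomial
open MvPolynomial
open Summit.ResolutionOfSingularities.ResolutionOfSingularities.Theorems.WildQuotientResolution.S1
open Summit.ResolutionOfSingularities.ResolutionOfSingularities.Theorems.WildQuotientResolution.S1.CoarseChart
open Summit.ResolutionOfSingularities.ResolutionOfSingularities.Theorems.WildQuotientResolution.S1.ReesBigrading
open Summit.ResolutionOfSingularities.ResolutionOfSingularities.Theorems.WildQuotientResolution.S1.BlowupCharts

namespace Summit.ResolutionOfSingularities.ResolutionOfSingularities.Theorems.WildQuotientResolution.S1.KillCert.Qh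

variable {k : Type} [Field k] {A : Type} [CommRing A]
  (σ : MvPolynomial (Fin 4) k ≃+* MvPolynomial (Fin 4) k)
  (h0 : σ (X 0) = X 0) (h1 : σ (X 1) = X 1 + X 0) (w : Fin 3 → ℕ) (sh : ℕ)
  (e : A ≃+* MvPolynomial (Fin 4) k) (τ : A ≃+* A) (hact : ∀ x : A, τ x = e.symm (σ (e x))) (hw0 : w 0 = w 1 + sh) {p : ℕ}

/-! ## The cover elements in `A` -/

/-- **Cover element 0**: `e⁻¹x₀ⁿ ∈ 𝒥_{dbar}` for `dbar = w₀·n`. -/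
theorem qh_cover_zero_mem (n dbar : ℕ) (hdbar : dbar = w 0 * n) :
    e.symm (X 0) ^ n ∈ (weightedFiltration (e.symm ∘ ![X 0, X 1, X 2] : Fin 3 → A) w).ideal dbar := by
  have h := GameFrame.GModel.pow_mem_weightedFiltration_ideal (e.symm ∘ ![X 0, X 1, X 2] : Fin 3 → A) w 0 n
  have e1 : n * w 0 = dbar := by rw [hdbar, Nat.mul_comm]
  rwa [e1] at h

include hw0 in
/-- The norm `N₁` lies in `𝒥_{p·w₁}` (each factor in `𝒥_{w₁}`, as `w₁ ≤ w₀`). -/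
theorem qh_norm_one_mem [NeZero p] :
    (∏ i : ZMod p, (e.symm (X 1) + (i.val : A) * e.symm (X 0))) ∈ (weightedFiltration (e.symm ∘ ![X 0, X 1, X 2] : Fin 3 → A) w).ideal (p * w 1) := by
  have hX0 : e.symm (X 0) ∈ (weightedFiltration (e.symm ∘ ![X 0, X 1, X 2] : Fin 3 → A) w).ideal (w 1) :=
    (weightedFiltration _ _).antitone (show w 1 ≤ w 0 by omega) (mem_weightedFiltration_ideal (e.symm ∘ ![X 0, X 1, X 2] : Fin 3 → A) w 0)
  have hfac : ∀ i : ZMod p, e.symm (X 1) + (i.val : A) * e.symm (X 0) ∈ (weightedFiltration (e.symm ∘ ![X 0, X 1, X 2] : Fin 3 → A) w).ideal (w 1) :=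
    fun i => add_mem (mem_weightedFiltration_ideal (e.symm ∘ ![X 0, X 1, X 2] : Fin 3 → A) w 1) (Ideal.mul_mem_left _ _ hX0)
  have := Ideal.prod_mem_prod (s := (Finset.univ : Finset (ZMod p))) (fun i _ => hfac i)
  rw [Finset.prod_const, Finset.card_univ, ZMod.card] at this
  have hle := Veronese.idealFiltration_pow_le (weightedFiltration (e.symm ∘ ![X 0, X 1, X 2] : Fin 3 → A) w) (w 1) p
  rw [Nat.mul_comm (w 1) p] at hle
  exact hle this

include hw0 in
/-- **Cover element 1**: `N₁ⁿ ∈ 𝒥_{dbar}` for `dbar = p·w₁·n`. -/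
theorem qh_cover_one_mem [NeZero p] (n dbar : ℕ) (hdbar : dbar = p * w 1 * n) :
    (∏ i : ZMod p, (e.symm (X 1) + (i.val : A) * e.symm (X 0))) ^ n ∈ (weightedFiltration (e.symm ∘ ![X 0, X 1, X 2] : Fin 3 → A) w).ideal dbar := by
  have h := Ideal.pow_mem_pow (qh_norm_one_mem w sh e hw0 (p := p)) n
  have hle := Veronese.idealFiltration_pow_le (weightedFiltration (e.symm ∘ ![X 0, X 1, X 2] : Fin 3 → A) w) (p * w 1) n
  rw [← hdbar] at hle
  exact hle h

include hact h0 h1 in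
/-- Cover element 1 is `τ`-fixed. -/
theorem qh_cover_one_fixed [NeZero p] [CharP A p] (hp1 : p ≠ 1) (n : ℕ) :
    τ ((∏ i : ZMod p, (e.symm (X 1) + (i.val : A) * e.symm (X 0))) ^ n) = (∏ i : ZMod p, (e.symm (X 1) + (i.val : A) * e.symm (X 0))) ^ n := by
  rw [map_pow, A1.a1_norm_fixed σ h0 h1 e τ hact hp1]

/-! ## The cover elements in `R^w` -/

include hw0 in
/-- `N₁·T^{p·w₁} = ∏ (u₁″ + i·(u₀″ s^sh))` in `A[T;T⁻¹]`, `u₁″ = C(e⁻¹x₁)T^{w₁}`, `u₀″ = C(e⁻¹x₀)T^{w₀}`. -/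
theorem qh_norm_one_T [NeZero p] : LaurentPolynomial.C (∏ i : ZMod p, (e.symm (X 1) + (i.val : A) * e.symm (X 0))) * LaurentPolynomial.T ((p * w 1 : ℕ) : ℤ) =
    ∏ i : ZMod p, (LaurentPolynomial.C (e.symm (X 1)) * LaurentPolynomial.T ((w 1 : ℕ) : ℤ) +
      (i.val : A[T;T⁻¹]) * (LaurentPolynomial.C (e.symm (X 0)) * LaurentPolynomial.T ((w 0 : ℕ) : ℤ) * LaurentPolynomial.T (-((sh : ℕ) : ℤ)))) := by
  have hfac : ∀ i : ZMod p, LaurentPolynomial.C (e.symm (X 1)) * LaurentPolynomial.T ((w 1 : ℕ) : ℤ) +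
      (i.val : A[T;T⁻¹]) * (LaurentPolynomial.C (e.symm (X 0)) * LaurentPolynomial.T ((w 0 : ℕ) : ℤ) * LaurentPolynomial.T (-((sh : ℕ) : ℤ))) =
      LaurentPolynomial.C (e.symm (X 1) + (i.val : A) * e.symm (X 0)) * LaurentPolynomial.T ((w 1 : ℕ) : ℤ) := by
    intro i
    rw [mul_assoc, ← LaurentPolynomial.T_add, map_add, map_mul, map_natCast]
    have e1 : ((w 0 : ℕ) : ℤ) + -((sh : ℕ) : ℤ) = ((w 1 : ℕ) : ℤ) := by rw [hw0]; push_cast; ring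
    rw [e1]; ring
  simp_rw [hfac]
  rw [Finset.prod_mul_distrib, ← map_prod, Finset.prod_const, Finset.card_univ, ZMod.card, LaurentPolynomial.T_pow, mul_comm (p : ℤ)]
  push_cast
  ring_nf

variable {m : ℕ} (mo : Fin m → ℕ) (𝒜 : (Π j : Fin m, ZMod (mo j)) → AddSubgroup A) [GradedRing 𝒜]
  (hf : ∀ i, (e.symm ∘ ![X 0, X 1, X 2] : Fin 3 → A) i ∈ 𝒜 ((fun _ => (0 : Π j : Fin m, ZMod (mo j))) i))
  {dbar : ℕ} (y : ↥(𝒜 0)) (hy : y ∈ (traceFiltration 𝒜 (e.symm ∘ ![X 0, X 1, X 2] : Fin 3 → A) w).ideal dbar)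

/-- **Cover element 0 in `R^w`**: `c₀ = u₀′ⁿ` when `(y : A) = (e⁻¹x₀)ⁿ` and `dbar = w₀·n`. -/
theorem qh_coverElement_zero_eq (n : ℕ) (hdbar : dbar = w 0 * n) (hyval : (y : A) = e.symm (X 0) ^ n) :
    coverElement 𝒜 (e.symm ∘ ![X 0, X 1, X 2] : Fin 3 → A) w dbar y hy = cobordantAlgebra.u' (e.symm ∘ ![X 0, X 1, X 2] : Fin 3 → A) w 0 ^ n := by
  symm
  refine Subtype.ext ?_
  rw [SubmonoidClass.coe_pow, cobordantAlgebra.coe_u', coe_coverElement, hyval, hdbar]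
  change (LaurentPolynomial.C (e.symm (X 0)) * LaurentPolynomial.T ((w 0 : ℕ) : ℤ)) ^ n = _
  rw [mul_pow, ← map_pow, LaurentPolynomial.T_pow]
  congr 2
  push_cast
  ring

include hw0 in
/-- **Cover element 1 in `R^w`**: `c₁ = (∏ᵢ (u₁′ + i·(u₀′ s^sh)))ⁿ` when `(y : A) = N₁ⁿ` and `dbar = p·w₁·n`. -/
theorem qh_coverElement_one_eq [NeZero p] (n : ℕ) (hdbar : dbar = p * w 1 * n)
    (hyval : (y : A) = (∏ i : ZMod p, (e.symm (X 1) + (i.val : A) * e.symm (X 0))) ^ n) :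
    coverElement 𝒜 (e.symm ∘ ![X 0, X 1, X 2] : Fin 3 → A) w dbar y hy =
      (∏ i : ZMod p, (cobordantAlgebra.u' (e.symm ∘ ![X 0, X 1, X 2] : Fin 3 → A) w 1 +
        algebraMap A _ (i.val : A) * (cobordantAlgebra.u' (e.symm ∘ ![X 0, X 1, X 2] : Fin 3 → A) w 0 *
          cobordantAlgebra.s (e.symm ∘ ![X 0, X 1, X 2] : Fin 3 → A) w ^ sh))) ^ n := by
  refine Subtype.ext ?_
  rw [SubmonoidClass.coe_pow, SubmonoidClass.coe_finsetProd, coe_coverElement, hyval, hdbar]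
  have hi : ∀ i : ZMod p, ((cobordantAlgebra.u' (e.symm ∘ ![X 0, X 1, X 2] : Fin 3 → A) w 1 +
      algebraMap A _ (i.val : A) * (cobordantAlgebra.u' (e.symm ∘ ![X 0, X 1, X 2] : Fin 3 → A) w 0 *
        cobordantAlgebra.s (e.symm ∘ ![X 0, X 1, X 2] : Fin 3 → A) w ^ sh) : ↥(cobordantAlgebra (e.symm ∘ ![X 0, X 1, X 2] : Fin 3 → A) w)) : A[T;T⁻¹]) =
      LaurentPolynomial.C (e.symm (X 1)) * LaurentPolynomial.T ((w 1 : ℕ) : ℤ) +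
        (i.val : A[T;T⁻¹]) * (LaurentPolynomial.C (e.symm (X 0)) * LaurentPolynomial.T ((w 0 : ℕ) : ℤ) * LaurentPolynomial.T (-((sh : ℕ) : ℤ))) := by
    intro i
    rw [AddMemClass.coe_add, MulMemClass.coe_mul, MulMemClass.coe_mul, cobordantAlgebra.coe_u', cobordantAlgebra.coe_u', cobordantAlgebra.coe_s_pow,
      cobordantAlgebra.coe_algebraMap, map_natCast]
    rfl
  simp_rw [hi]
  rw [← qh_norm_one_T w sh e hw0 (p := p), mul_pow, ← map_pow, LaurentPolynomial.T_pow]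
  congr 2
  push_cast
  ring

/-! ## Residual sections -/

include hf in
/-- `u₀′ⁿ` has bidegree `(w₀·n, 0)`. -/
theorem qh_u'_zero_pow_mem_reesPiece (n : ℕ) :
    cobordantAlgebra.u' (e.symm ∘ ![X 0, X 1, X 2] : Fin 3 → A) w 0 ^ n ∈
      reesPiece 𝒜 (e.symm ∘ ![X 0, X 1, X 2] : Fin 3 → A) w ((((w 0 * n : ℕ)) : ℤ), (0 : Π j : Fin m, ZMod (mo j))) := by
  letI := reesGradedRing 𝒜 (e.symm ∘ ![X 0, X 1, X 2] : Fin 3 → A) w hf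
  have h := SetLike.pow_mem_graded n (u'_mem_reesPiece 𝒜 (e.symm ∘ ![X 0, X 1, X 2] : Fin 3 → A) (δ := fun _ => 0) w hf 0)
  have e1 : n • ((((w 0 : ℕ)) : ℤ), (fun _ => (0 : Π j : Fin m, ZMod (mo j))) (0 : Fin 3)) = ((((w 0 * n : ℕ)) : ℤ), (0 : Π j : Fin m, ZMod (mo j))) := by
    refine Prod.ext ?_ ?_
    · change n • (((w 0 : ℕ) : ℤ)) = (((w 0 * n : ℕ)) : ℤ); rw [nsmul_eq_mul]; push_cast; ring
    · change n • (0 : Π j : Fin m, ZMod (mo j)) = 0; exact smul_zero _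
  rwa [e1] at h

include hf in
/-- ★ **Residual section 0** on the chart of `c = yT^{dbar}` (`dbar = w₀·n`): `u₀′ⁿ/c` has degree `0` and lies in `𝔞·R_c` for every ideal `𝔞 ∋ u₀′`. -/
theorem qh_residualSection_zero (n : ℕ) (hdbar : dbar = w 0 * n) (𝔞 : Ideal ↥(cobordantAlgebra (e.symm ∘ ![X 0, X 1, X 2] : Fin 3 → A) w))
    (h𝔞 : cobordantAlgebra.u' (e.symm ∘ ![X 0, X 1, X 2] : Fin 3 → A) w 0 ∈ 𝔞) (hn : 0 < n) :
    algebraMap _ (ChartRing 𝒜 (e.symm ∘ ![X 0, X 1, X 2] : Fin 3 → A) w dbar y hy)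
          (cobordantAlgebra.u' (e.symm ∘ ![X 0, X 1, X 2] : Fin 3 → A) w 0 ^ n) *
        IsLocalization.Away.invSelf (coverElement 𝒜 (e.symm ∘ ![X 0, X 1, X 2] : Fin 3 → A) w dbar y hy) ∈
        chartNodeGrading mo 𝒜 (e.symm ∘ ![X 0, X 1, X 2] : Fin 3 → A) w hf dbar y hy 0 ∧
      algebraMap _ (ChartRing 𝒜 (e.symm ∘ ![X 0, X 1, X 2] : Fin 3 → A) w dbar y hy)
          (cobordantAlgebra.u' (e.symm ∘ ![X 0, X 1, X 2] : Fin 3 → A) w 0 ^ n) *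
        IsLocalization.Away.invSelf (coverElement 𝒜 (e.symm ∘ ![X 0, X 1, X 2] : Fin 3 → A) w dbar y hy) ∈
        𝔞.map (algebraMap _ (ChartRing 𝒜 (e.symm ∘ ![X 0, X 1, X 2] : Fin 3 → A) w dbar y hy)) := by
  refine ⟨residualSection_mem_chartNodeGrading_zero mo 𝒜 _ _ hf y hy ?_, residualSection_mem_map mo 𝒜 _ _ y hy (Ideal.pow_mem_of_mem 𝔞 h𝔞 _ hn)⟩
  have h := qh_u'_zero_pow_mem_reesPiece w e mo 𝒜 hf n
  rwa [← hdbar] at h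

include hf in
/-- ★ **Residual section from a second cover element**: for `y′ ∈ K_{dbar}` with `y′T^{dbar} ∈ 𝔞`, the transition section `c′/c` has degree `0` and lies in `𝔞·R_c`
(on the chart of `c′` itself it is `1`: that chart is KILLED). -/
theorem qh_residualSection_of_mem (y' : ↥(𝒜 0)) (hy' : y' ∈ (traceFiltration 𝒜 (e.symm ∘ ![X 0, X 1, X 2] : Fin 3 → A) w).ideal dbar)
    (𝔞 : Ideal ↥(cobordantAlgebra (e.symm ∘ ![X 0, X 1, X 2] : Fin 3 → A) w)) (h𝔞 : coverElement 𝒜 (e.symm ∘ ![X 0, X 1, X 2] : Fin 3 → A) w dbar y' hy' ∈ 𝔞) :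
    algebraMap _ (ChartRing 𝒜 (e.symm ∘ ![X 0, X 1, X 2] : Fin 3 → A) w dbar y hy) (coverElement 𝒜 (e.symm ∘ ![X 0, X 1, X 2] : Fin 3 → A) w dbar y' hy') *
        IsLocalization.Away.invSelf (coverElement 𝒜 (e.symm ∘ ![X 0, X 1, X 2] : Fin 3 → A) w dbar y hy) ∈
        chartNodeGrading mo 𝒜 (e.symm ∘ ![X 0, X 1, X 2] : Fin 3 → A) w hf dbar y hy 0 ∧
      algebraMap _ (ChartRing 𝒜 (e.symm ∘ ![X 0, X 1, X 2] : Fin 3 → A) w dbar y hy) (coverElement 𝒜 (e.symm ∘ ![X 0, X 1, X 2] : Fin 3 → A) w dbar y' hy') *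
        IsLocalization.Away.invSelf (coverElement 𝒜 (e.symm ∘ ![X 0, X 1, X 2] : Fin 3 → A) w dbar y hy) ∈
        𝔞.map (algebraMap _ (ChartRing 𝒜 (e.symm ∘ ![X 0, X 1, X 2] : Fin 3 → A) w dbar y hy)) :=
  ⟨transitionSection_mem_chartNodeGrading_zero mo 𝒜 _ _ hf y hy y' hy', residualSection_mem_map mo 𝒜 _ _ y hy h𝔞⟩

/-! ## The radical step for `u₀′, u₁′` -/

/-- **`u₀′, u₁′ ∈ √(c)`** for any family `c` of elements of `R^w` containing `u₀′^{n₀}` (`n₀ > 0`) and `(∏ᵢ (u₁′ + i·u₀′s^sh))^{n₁}` (`n₁ > 0`).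
[OURS · L1 W4.5c · R4 quasi-homogeneous root, `hrad` for the first two generators] -/
theorem qh_rad_zero_one [NeZero p] {ι : Type} (c : ι → ↥(cobordantAlgebra (e.symm ∘ ![X 0, X 1, X 2] : Fin 3 → A) w)) (i₀ i₁ : ι) {n₀ n₁ : ℕ}
    (hn₀ : 0 < n₀) (hn₁ : 0 < n₁)
    (hc₀ : c i₀ = cobordantAlgebra.u' (e.symm ∘ ![X 0, X 1, X 2] : Fin 3 → A) w 0 ^ n₀)
    (hc₁ : c i₁ = (∏ i : ZMod p, (cobordantAlgebra.u' (e.symm ∘ ![X 0, X 1, X 2] : Fin 3 → A) w 1 +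
        algebraMap A _ (i.val : A) * (cobordantAlgebra.u' (e.symm ∘ ![X 0, X 1, X 2] : Fin 3 → A) w 0 *
          cobordantAlgebra.s (e.symm ∘ ![X 0, X 1, X 2] : Fin 3 → A) w ^ sh))) ^ n₁) :
    cobordantAlgebra.u' (e.symm ∘ ![X 0, X 1, X 2] : Fin 3 → A) w 0 ∈ (Ideal.span (Set.range c)).radical ∧
      cobordantAlgebra.u' (e.symm ∘ ![X 0, X 1, X 2] : Fin 3 → A) w 1 ∈ (Ideal.span (Set.range c)).radical := by
  have hX0rad : cobordantAlgebra.u' (e.symm ∘ ![X 0, X 1, X 2] : Fin 3 → A) w 0 ∈ (Ideal.span (Set.range c)).radical :=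
    ⟨n₀, by rw [← hc₀]; exact Ideal.subset_span ⟨i₀, rfl⟩⟩
  have _ := hn₀
  refine ⟨hX0rad, ?_⟩
  have hBrad : cobordantAlgebra.u' (e.symm ∘ ![X 0, X 1, X 2] : Fin 3 → A) w 0 * cobordantAlgebra.s (e.symm ∘ ![X 0, X 1, X 2] : Fin 3 → A) w ^ sh ∈
      (Ideal.span (Set.range c)).radical := Ideal.mul_mem_right _ _ hX0rad
  have hP : (∏ i : ZMod p, (cobordantAlgebra.u' (e.symm ∘ ![X 0, X 1, X 2] : Fin 3 → A) w 1 +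
        algebraMap A _ (i.val : A) * (cobordantAlgebra.u' (e.symm ∘ ![X 0, X 1, X 2] : Fin 3 → A) w 0 *
          cobordantAlgebra.s (e.symm ∘ ![X 0, X 1, X 2] : Fin 3 → A) w ^ sh))) ∈ (Ideal.span (Set.range c)).radical := by
    refine Ideal.mem_radical_of_pow_mem (m := n₁) ?_
    rw [← hc₁]; exact Ideal.le_radical (Ideal.subset_span ⟨i₁, rfl⟩)
  have _ := hn₁
  exact Sym.mem_radical_of_prod_add_mul _ _ _ (fun i => algebraMap A _ (i.val : A)) hBrad hP

end Summit.ResolutionOfSingularities.ResolutionOfSingularities.Theorems.WildQuotientResolution.S1.KillCert.Qh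

end
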